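import Summits.KontsevichZagierPeriods.Zeta5Search.WedgeDictionaryIntegralPartPQ
import HarnessLib

/-!
# The four-term contiguity of the cellular integrals in DET form, and the pointwise induction step for `explicitPQ`

HONEST FRAMING: systematic search; no irrationality claim unless certified.
OUR work (Summit side; cell `pub-zeta5`, planner gen-1 g13, 2026-08-20; memo `pub-zeta5-gen-1/D2-CONTIGUITY-g13.md`).

`explicitPQ` (`WedgeDictionaryIntegralPartPQ`) says `I(a) = v(a) · (θ, −4ζ(2), −2)` with `θ = 2ζ(5)+4ζ(3)ζ(2)` and the
DICTIONARY VECTOR `v(a) = (Q(a), P̂_d(a), P_d(a)) ∈ ℚ³` (`dictPhat`, `dictP` below; `explicitPQ_iff_at`).  For a cluster of four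
lattice points `a₀,…,a₃` the four vectors `v(aᵢ) ∈ ℚ³` are linearly dependent with the signed `3×3` minors `Mᵢ` as
coefficients (Cramer), so `explicitPQ` at the four points implies the FOUR-TERM RELATION among real numbers
`Σᵢ (−1)ⁱ Mᵢ · I(aᵢ) = 0` (`ClusterRelation`; `clusterRelation_of_at`, PROVED: a `4×4` determinant with a dependent column).
Conversely — and this is the point — the relation at a cluster plus `explicitPQ` at three of its points plus `M₃ ≠ 0`
gives `explicitPQ` at the fourth point (`at_of_clusterRelation`, PROVED): the INDUCTION STEP that propagates `explicitPQ`
from the diagonal `a = n·1⁸` (where it is `SymRay.explicitPQ_diag_allj`, mod BZ Sect. 2 facts) to general `a`, one lattice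
point at a time, using only identities between REAL numbers (no linear independence of `1, ζ(2), θ` is needed anywhere).
The conjecture `fourTermContiguity` (INTERNALLY MINTED) records the relations for the unit stencils
`(a, a+e₁, a+e₂, a±e_k)`; it is a CONSEQUENCE of `explicitPQ` (`fourTermContiguity_of_explicitPQ`, PROVED), hence not
stronger than what is already conjectured, and it is the part that an integrand-level creative-telescoping certificate
plus the contour-shift lemma would prove (memo §1, §6: the contiguity module of BZ's double Barnes integral in the kernel
normalisation has rank 3 and its relations are exactly these — 116 + 254 instances checked, 15 certified over ℚ, among them
the `n = 5` instance of BZ's Sect. 2 recursion).  What this file is NOT: a proof of any instance of `ClusterRelation`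
(that needs the analytic lemma), nor anything about irrationality.
-/

noncomputable section

open Finset

namespace Summit.KontsevichZagierPeriods.Zeta5Search.WedgeDictionary

open Summit.KontsevichZagierPeriods.Zeta5Search.DualSeries
open Literature.NumberTheory.Irrationality.BrownZudilin2022 (vwpDual bOfA Converges cellularIntegral QOf)
open Literature.NumberTheory.Transcendental (zetaValue)

/-- The dictionary `P̂`-part `ρ(a)·(U(b)V(b′) − U(b′)V(b))`, `b = b(a)`, `b′ = b + e_j`. -/
def dictPhat (a : Fin 8 → ℤ) (j : ℕ) : ℚ :=
  rhoOf a * (coeffU (bOfA a) * coeffV (Function.update (bOfA a) j (bOfA a j + 1)) -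
    coeffU (Function.update (bOfA a) j (bOfA a j + 1)) * coeffV (bOfA a))

/-- The dictionary `P`-part `ρ(a)·(W(b′)V(b) − W(b)V(b′))`. -/
def dictP (a : Fin 8 → ℤ) (j : ℕ) : ℚ :=
  rhoOf a * (coeffW (Function.update (bOfA a) j (bOfA a j + 1)) * coeffV (bOfA a) -
    coeffW (bOfA a) * coeffV (Function.update (bOfA a) j (bOfA a j + 1)))

/-- The hypotheses of `explicitPQ` at the point `a` with the contiguous direction `j`. -/
def RegionHyp (a : Fin 8 → ℤ) (j : ℕ) : Prop :=
  j ∈ Icc 1 7 ∧ Converges a ∧ (∀ i ∈ Icc 1 7, 0 ≤ bOfA a i ∧ 2 * bOfA a i ≤ bOfA a 0 + 1) ∧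
    0 ≤ dOf (bOfA a) ∧ 2 * (bOfA a j + 1) ≤ bOfA a 0 + 1

/-- `explicitPQ` at one point: `I(a) = Q(a)θ − 4P̂_d(a)ζ(2) − 2P_d(a)`. -/
def ExplicitPQAt (a : Fin 8 → ℤ) (j : ℕ) : Prop :=
  cellularIntegral a =
    (QOf a : ℝ) * (2 * zetaValue 5 + 4 * zetaValue 3 * zetaValue 2) - 4 * (dictPhat a j : ℝ) * zetaValue 2 -
      2 * (dictP a j : ℝ)

/-- `explicitPQ` is the conjunction of its pointwise instances. -/
theorem explicitPQ_iff_at : explicitPQ ↔ ∀ (a : Fin 8 → ℤ) (j : ℕ), RegionHyp a j → ExplicitPQAt a j := by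
  constructor
  · intro h a j hr
    obtain ⟨hj, hc, hreg, hd, hp⟩ := hr
    have := h a j hj hc hreg hd hp
    unfold ExplicitPQAt dictPhat dictP
    exact this
  · intro h a j hj hc hreg hd hp
    have := h a j ⟨hj, hc, hreg, hd, hp⟩
    unfold ExplicitPQAt dictPhat dictP at this
    exact this

/-- The `3×3` determinant of the dictionary vectors `(Q, P̂_d, P_d)` at three points. -/
def dictDet (a₀ a₁ a₂ : Fin 8 → ℤ) (j : ℕ) : ℚ :=
  (QOf a₀ : ℚ) * (dictPhat a₁ j * dictP a₂ j - dictP a₁ j * dictPhat a₂ j) -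
    dictPhat a₀ j * ((QOf a₁ : ℚ) * dictP a₂ j - dictP a₁ j * (QOf a₂ : ℚ)) +
      dictP a₀ j * ((QOf a₁ : ℚ) * dictPhat a₂ j - dictPhat a₁ j * (QOf a₂ : ℚ))

/-- The four-term contiguity relation of the cellular integrals on the cluster `(a₀, a₁, a₂, a₃)` in DET form:
`M(a₁,a₂,a₃)·I(a₀) − M(a₀,a₂,a₃)·I(a₁) + M(a₀,a₁,a₃)·I(a₂) − M(a₀,a₁,a₂)·I(a₃) = 0`. -/
def ClusterRelation (a₀ a₁ a₂ a₃ : Fin 8 → ℤ) (j : ℕ) : Prop :=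
  (dictDet a₁ a₂ a₃ j : ℝ) * cellularIntegral a₀ - (dictDet a₀ a₂ a₃ j : ℝ) * cellularIntegral a₁ +
      (dictDet a₀ a₁ a₃ j : ℝ) * cellularIntegral a₂ - (dictDet a₀ a₁ a₂ j : ℝ) * cellularIntegral a₃ = 0

/-- `explicitPQ` at the four points of a cluster implies the four-term relation (Cramer / a `4×4` determinant with a
column that is a combination of the other three). -/
theorem clusterRelation_of_at {a₀ a₁ a₂ a₃ : Fin 8 → ℤ} {j : ℕ} (h₀ : ExplicitPQAt a₀ j) (h₁ : ExplicitPQAt a₁ j)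
    (h₂ : ExplicitPQAt a₂ j) (h₃ : ExplicitPQAt a₃ j) : ClusterRelation a₀ a₁ a₂ a₃ j := by
  unfold ClusterRelation dictDet
  unfold ExplicitPQAt at h₀ h₁ h₂ h₃
  rw [h₀, h₁, h₂, h₃]
  push_cast
  ring

/-- **The induction step.** The four-term relation on a cluster, `explicitPQ` at three of its points and the
non-vanishing of their dictionary determinant give `explicitPQ` at the fourth point. -/
theorem at_of_clusterRelation {a₀ a₁ a₂ a₃ : Fin 8 → ℤ} {j : ℕ} (hrel : ClusterRelation a₀ a₁ a₂ a₃ j)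
    (h₀ : ExplicitPQAt a₀ j) (h₁ : ExplicitPQAt a₁ j) (h₂ : ExplicitPQAt a₂ j) (hdet : dictDet a₀ a₁ a₂ j ≠ 0) :
    ExplicitPQAt a₃ j := by
  unfold ClusterRelation dictDet at hrel
  unfold ExplicitPQAt at h₀ h₁ h₂ ⊢
  rw [h₀, h₁, h₂] at hrel
  push_cast at hrel
  have hdet' : (dictDet a₀ a₁ a₂ j : ℝ) ≠ 0 := by exact_mod_cast hdet
  unfold dictDet at hdet'
  push_cast at hdet'
  -- `hrel` reads `M₃ · (RHS(a₃) − I(a₃)) = 0` after expansion; cancel `M₃`.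
  have key : ((QOf a₀ : ℝ) * ((dictPhat a₁ j : ℝ) * (dictP a₂ j : ℝ) - (dictP a₁ j : ℝ) * (dictPhat a₂ j : ℝ)) -
      (dictPhat a₀ j : ℝ) * ((QOf a₁ : ℝ) * (dictP a₂ j : ℝ) - (dictP a₁ j : ℝ) * (QOf a₂ : ℝ)) +
      (dictP a₀ j : ℝ) * ((QOf a₁ : ℝ) * (dictPhat a₂ j : ℝ) - (dictPhat a₁ j : ℝ) * (QOf a₂ : ℝ))) *
      (cellularIntegral a₃ - ((QOf a₃ : ℝ) * (2 * zetaValue 5 + 4 * zetaValue 3 * zetaValue 2) -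
        4 * (dictPhat a₃ j : ℝ) * zetaValue 2 - 2 * (dictP a₃ j : ℝ))) = 0 := by
    linear_combination (-1 : ℝ) * hrel
  rcases mul_eq_zero.1 key with h | h
  · exact absurd h hdet'
  · linarith

/-- The `k`-th unit vector of the `a`-lattice. -/
def unitVec (k : Fin 8) : Fin 8 → ℤ := fun i => if i = k then 1 else 0

/-- **Four-term contiguity of the cellular integrals (INTERNALLY MINTED; conjecture).** For the unit stencils
`(a, a+e₁, a+e₂, a+e_k)` and `(a, a+e₁, a+e₂, a−e_k)` whose four points satisfy the hypotheses of `explicitPQ` (same `j`),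
the DET-form four-term relation holds.  Evidence: memo §2–§5 (integrand-level certificates in the kernel normalisation of
BZ's double Barnes integral; 15 exact over ℚ, 370 mod p, all equal to the dictionary relation).  It is implied by
`explicitPQ` (`fourTermContiguity_of_explicitPQ`). Here `e₁, e₂` are the slots `0, 1` of `Fin 8`. -/
@[conjecture] def fourTermContiguity : Prop :=
  ∀ (a : Fin 8 → ℤ) (k : Fin 8) (j : ℕ),
    RegionHyp a j → RegionHyp (a + unitVec 0) j → RegionHyp (a + unitVec 1) j →
      (RegionHyp (a + unitVec k) j → ClusterRelation a (a + unitVec 0) (a + unitVec 1) (a + unitVec k) j) ∧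
      (RegionHyp (a - unitVec k) j → ClusterRelation a (a + unitVec 0) (a + unitVec 1) (a - unitVec k) j)

/-- The contiguity conjecture is a consequence of `explicitPQ`. -/
theorem fourTermContiguity_of_explicitPQ (h : explicitPQ) : fourTermContiguity := by
  rw [explicitPQ_iff_at] at h
  intro a k j ha h0 h1
  exact ⟨fun hk => clusterRelation_of_at (h _ _ ha) (h _ _ h0) (h _ _ h1) (h _ _ hk),
    fun hk => clusterRelation_of_at (h _ _ ha) (h _ _ h0) (h _ _ h1) (h _ _ hk)⟩


end Summit.KontsevichZagierPeriods.Zeta5Search.WedgeDictionary
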